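import Literature.NumberTheory.Transcendental.PadicCW77Setup
import Summits.ABC.StewartYu.DescentSetupQ
import HarnessLib

/-!
# Cell abc-stewartyu, WP-Y3 (i): the TWISTED `p`-adic set-up over `ℚ_p` — data, twisted
# generators, class values, logarithms, the linear form

`Summits/ABC/StewartYu/PadicTwistSetup.lean` — cell `abc-stewartyu` (HOME
`run/shared/lean/pub/abc-stewartyu/`, seat p2; route `PadicPrimesYuNinety`, crux
`YuNinetyThreeModFour` stmt-ABC-19249, line `twist-w80`, design memo HOME/p2/memo-04).
Plain definitions and theorems; no named fact.

This is the twin of p2's `PadicCW77Setup.lean` (PRINCIPAL units) for ARBITRARY rational `p`-adic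
units, following Yu's Teichmüller twist [Yu 1990, (2.19)–(2.25)]: each generator `allᵢ ∈ ℚ` is
multiplied by a root of unity `ηᵢ ∈ ℚ_p` of a common ODD order `G` (`ηᵢ^G = 1`) so that
`ωᵢ := allᵢ · ηᵢ` is a principal unit (`‖ωᵢ − 1‖ ≤ p⁻¹`).  The analytic side (logarithms
`log_p ωᵢ`, the linear form `Λ`) is the principal-unit one applied to the `ωᵢ`; the algebraic side
is p3's SIGN-FREE `SetupQ` (`DescentSetupQ.lean`) reached through `S.toQ`.  The twist shows at the
points through the CLASS VALUE `cls u = ∏ᵢ ηᵢ^{λᵢ} ∈ μ_G` (value identities in the sequel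
`PadicTwistValues.lean`; because `G` is odd, `ηᵢ` has the square root `ηᵢ^{(G+1)/2}` inside `μ_G`,
so even the half points need no extension of `ℚ_p` — the case `p ≡ 3 (mod 4)`, `G = (p−1)/2`,
HOME/p2/memo-04 §4).  Finally `‖Λ‖ = ‖Θ − 1‖_p` as soon as `Θ = ∏ allᵢ^{bᵢ}` is a principal unit
(`norm_Λ_of_principal`): the root of unity `∏ ηᵢ^{bᵢ}` is then principal AND of odd order, hence `1`.

## References
* [Yu1990] K. Yu, *Linear forms in p-adic logarithms II*, Compositio Math. 74 (1990), §2
  (2.19)–(2.25) (the twist), §1.1 (exp/log on principal units).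
* [CijsouwWaldschmidt1977] P. L. Cijsouw, M. Waldschmidt, Compositio Math. 34 (1977), §4.
-/

noncomputable section

open NormedSpace Finset IsUltrametricDist
open Literature.NumberTheory.Transcendental
open Literature.NumberTheory.Transcendental.CW77.Setup (Idx Tau tauNorm)
open scoped Nat

namespace Summit.ABC.StewartYu

/-- **The data of the twisted `p`-adic set-up** at an odd prime `p`: `d` free rational units
`αⱼ`, the eliminated rational unit `θ`, integer coefficients `bⱼ` and `b_θ ≠ 0` of minimal `p`-adic
order, a natural number `G > 0` (ODD for the `ℚ_p` half step of provider A), and for every generator a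
root of unity `ηᵢ ∈ ℚ_p` with `ηᵢ^G = 1` making `allᵢ · ηᵢ` a principal unit. [cite: Yu1990, §2 (2.19)–(2.24)] -/
structure TwistSetup (p : ℕ) [Fact p.Prime] where
  /-- the prime is odd -/
  hp3 : 3 ≤ p
  /-- the number of free generators -/
  d : ℕ
  /-- the free generators -/
  α : Fin d → ℚ
  /-- the eliminated generator -/
  θ : ℚ
  /-- the free generators are non-zero -/
  α_ne : ∀ j, α j ≠ 0
  /-- the eliminated generator is non-zero -/
  θ_ne : θ ≠ 0
  /-- the coefficients of the free logarithms -/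
  b : Fin d → ℤ
  /-- the coefficient of `log_p θ` -/
  bθ : ℤ
  /-- it is non-zero -/
  bθ_ne : bθ ≠ 0
  /-- it has MINIMAL `p`-adic order among the non-zero coefficients -/
  hbmin : ∀ j, b j ≠ 0 → padicValInt p bθ ≤ padicValInt p (b j)
  /-- the common order of the twisting roots of unity (odd for provider A, `p ≡ 3 (mod 4)`) -/
  G : ℕ
  /-- it is positive -/
  hG : 0 < G
  /-- the twisting roots of unity, one for each of the `d + 1` generators (`θ` last) -/
  η : Fin (d + 1) → ℚ_[p]
  /-- `ηᵢ^G = 1` -/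
  hηG : ∀ i, η i ^ G = 1
  /-- the twisted generators are principal units -/
  hprin : ∀ i, ‖((Fin.snoc α θ : Fin (d + 1) → ℚ) i : ℚ_[p]) * η i - 1‖ ≤ (p : ℝ)⁻¹

namespace TwistSetup

variable {p : ℕ} [Fact p.Prime] (S : TwistSetup p)

/-! ### Elementary facts about `p` and `G` -/

/-- `3 ≤ p` as a real number. [folklore] -/
theorem three_le_p (S : TwistSetup p) : (3 : ℝ) ≤ p := by exact_mod_cast S.hp3

/-- `1 < p` as a real number. [folklore] -/
theorem one_lt_p (S : TwistSetup p) : (1 : ℝ) < p := by linarith [S.three_le_p]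

/-- `p⁻¹ < 1`. [folklore] -/
theorem inv_p_lt_one (S : TwistSetup p) : (p : ℝ)⁻¹ < 1 := inv_lt_one_of_one_lt₀ S.one_lt_p

/-- `0 ≤ p⁻¹`. [folklore] -/
theorem inv_p_nonneg (S : TwistSetup p) : (0 : ℝ) ≤ (p : ℝ)⁻¹ := by
  have := S.one_lt_p; positivity

/-- `2 · ((G−1)/2) + 1 = G` and `((G+1)/2) + ((G−1)/2) = G` when `G` is odd. [folklore] -/
theorem two_mul_half_add_one (hodd : Odd S.G) :
    2 * ((S.G - 1) / 2) + 1 = S.G ∧ (S.G + 1) / 2 + (S.G - 1) / 2 = S.G := by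
  obtain ⟨k, hk⟩ := hodd; omega

/-- `2 · ((G+1)/2) = G + 1` when `G` is odd. [folklore] -/
theorem two_mul_half_succ (hodd : Odd S.G) : 2 * ((S.G + 1) / 2) = S.G + 1 := by
  obtain ⟨k, hk⟩ := hodd; omega

/-! ### All generators, the sign-free algebraic datum `toQ`, the frame -/

/-- **The sign-free algebraic datum** (p3's `SetupQ`: same `d, α, θ, b, b_θ`), through which every
rational object of the descent (`all`, `qE`, `qTerm`, `coreSum`, `classVec`, `Inv`, …) is imported.
[folklore] -/
abbrev toQ : SetupQ := ⟨S.d, S.α, S.θ, S.α_ne, S.θ_ne, S.b, S.bθ, S.bθ_ne⟩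

/-- **The frame**: the positive `CW77.Setup` `S.toQ.flat` carrying all generator-free bookkeeping
(`Idx`, `Tau`, `β`, `γ`, `qΔ`, `qA`, `expn`, boxes). [cite: CijsouwWaldschmidt1977, §4 (p. 184)] -/
abbrev frame : CW77.Setup := S.toQ.flat

/-- The twisted generator `ωᵢ = allᵢ · ηᵢ ∈ ℚ_p` (a principal unit); `all = (α, θ)` is `S.toQ.all`.
[cite: Yu1990, §2 (2.24)] -/
def ω (i : Fin (S.d + 1)) : ℚ_[p] := (S.toQ.all i : ℚ_[p]) * S.η i

/-- **The twisted generators are principal units**: `‖1 − ωᵢ‖ ≤ p⁻¹`. [cite: Yu1990, §2 (2.24)] -/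
theorem norm_one_sub_ω_le (i : Fin (S.d + 1)) : ‖1 - S.ω i‖ ≤ (p : ℝ)⁻¹ := by
  rw [norm_sub_rev]; exact S.hprin i

/-- `‖ηᵢ‖ = 1` (a root of unity). [folklore] -/
theorem norm_η (i : Fin (S.d + 1)) : ‖S.η i‖ = 1 := by
  have h := congrArg (‖·‖) (S.hηG i)
  simp only [norm_pow, norm_one] at h
  exact (pow_eq_one_iff_of_nonneg (norm_nonneg _) S.hG.ne').mp h

/-- `ηᵢ ≠ 0`. [folklore] -/
theorem η_ne (i : Fin (S.d + 1)) : S.η i ≠ 0 :=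
  norm_pos_iff.mp (by rw [S.norm_η]; exact one_pos)

/-- `‖ωᵢ‖ = 1`. [folklore] -/
theorem norm_ω (i : Fin (S.d + 1)) : ‖S.ω i‖ = 1 :=
  IwasawaLog.norm_eq_one_of_norm_one_sub_lt ((S.norm_one_sub_ω_le i).trans_lt S.inv_p_lt_one)

/-- **The generators are `p`-adic units**: `‖allᵢ‖_p = 1`. [cite: Yu1990, Theorem 2.1 (2.16)] -/
theorem norm_all (i : Fin (S.d + 1)) : ‖(S.toQ.all i : ℚ_[p])‖ = 1 := by
  have h := S.norm_ω i
  unfold ω at h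
  rwa [norm_mul, S.norm_η, mul_one] at h

/-- Components of `expn`: `expn (castSucc j) = λⱼ s`. [folklore] -/
@[simp] theorem frame_expn_castSucc {h Lb : ℕ} (u : Idx S.d h Lb) (s : ℕ) (j : Fin S.d) :
    S.frame.expn u s (Fin.castSucc j) = u.2.1 j * s := SetupQ.flat_expn_castSucc S.toQ u s j

/-- Components of `expn`: `expn last = λ_θ s`. [folklore] -/
@[simp] theorem frame_expn_last {h Lb : ℕ} (u : Idx S.d h Lb) (s : ℕ) :
    S.frame.expn u s (Fin.last S.d) = u.2.2 * s := SetupQ.flat_expn_last S.toQ u s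

/-- Components of `resVec`. [folklore] -/
@[simp] theorem frame_resVec_castSucc (ε : Fin S.d → ℕ) (εθ : ℕ) (j : Fin S.d) :
    S.frame.resVec ε εθ (Fin.castSucc j) = ε j := SetupQ.flat_resVec_castSucc S.toQ ε εθ j

/-- Components of `resVec`. [folklore] -/
@[simp] theorem frame_resVec_last (ε : Fin S.d → ℕ) (εθ : ℕ) :
    S.frame.resVec ε εθ (Fin.last S.d) = εθ := SetupQ.flat_resVec_last S.toQ ε εθ

/-- Components of `reidx`. [folklore] -/
@[simp] theorem frame_reidx_snd_fst {h Lb : ℕ} (ε : Fin S.d → ℕ) (εθ : ℕ) (v : Idx S.d h Lb) (j : Fin S.d) :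
    (S.frame.reidx ε εθ v).2.1 j = ε j + 2 * v.2.1 j := rfl

/-- Components of `reidx`. [folklore] -/
@[simp] theorem frame_reidx_snd_snd {h Lb : ℕ} (ε : Fin S.d → ℕ) (εθ : ℕ) (v : Idx S.d h Lb) :
    (S.frame.reidx ε εθ v).2.2 = εθ + 2 * v.2.2 := rfl

/-- Components of `expn` at the point `1`: `λⱼ`. [folklore] -/
@[simp] theorem expn_one_castSucc {h Lb : ℕ} (u : Idx S.d h Lb) (j : Fin S.d) :
    S.frame.expn u 1 (Fin.castSucc j) = u.2.1 j := by
  rw [S.frame_expn_castSucc, mul_one]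

/-- Components of `expn` at the point `1`: `λ_θ`. [folklore] -/
@[simp] theorem expn_one_last {h Lb : ℕ} (u : Idx S.d h Lb) : S.frame.expn u 1 (Fin.last S.d) = u.2.2 := by
  rw [S.frame_expn_last, mul_one]

/-- `expnᵢ(u, s) = expnᵢ(u, 1) · s`. [folklore] -/
theorem expn_eq_expn_one_mul {h Lb : ℕ} (u : Idx S.d h Lb) (s : ℕ) (i : Fin (S.d + 1)) :
    S.frame.expn u s i = S.frame.expn u 1 i * s := by
  refine Fin.lastCases ?_ (fun j => ?_) i
  · rw [S.frame_expn_last, S.expn_one_last]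
  · rw [S.frame_expn_castSucc, S.expn_one_castSucc]

/-! ### The class value of an unknown -/

variable {h Lb : ℕ}

/-- **The class value** `cls u = ∏ᵢ ηᵢ^{λᵢ(u)} ∈ μ_G ⊂ ℚ_p` of the unknown `u` (the root of unity by
which the twist shows at the integer points). [cite: Yu1990, §2.3 (2.54)] -/
def cls (u : Idx S.d h Lb) : ℚ_[p] := ∏ i, S.η i ^ S.frame.expn u 1 i

/-- `(cls u)^G = 1`. [folklore] -/
theorem cls_pow_G (u : Idx S.d h Lb) : S.cls u ^ S.G = 1 := by
  unfold cls
  rw [← prod_pow]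
  exact prod_eq_one fun i _ => by rw [← pow_mul, mul_comm, pow_mul, S.hηG, one_pow]

/-- `‖cls u‖ = 1`. [folklore] -/
theorem norm_cls (u : Idx S.d h Lb) : ‖S.cls u‖ = 1 := by
  unfold cls; rw [norm_prod]
  exact prod_eq_one fun i _ => by rw [norm_pow, S.norm_η, one_pow]

/-- `cls u ≠ 0`. [folklore] -/
theorem cls_ne (u : Idx S.d h Lb) : S.cls u ≠ 0 :=
  norm_pos_iff.mp (by rw [S.norm_cls]; exact one_pos)

/-- `(cls u)^s = ∏ᵢ ηᵢ^{expnᵢ(u,s)}`. [folklore] -/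
theorem cls_pow (u : Idx S.d h Lb) (s : ℕ) : S.cls u ^ s = ∏ i, S.η i ^ S.frame.expn u s i := by
  unfold cls
  rw [← prod_pow]
  exact prod_congr rfl fun i _ => by rw [← pow_mul, S.expn_eq_expn_one_mul u s i]

/-! ### The logarithms -/

/-- `log_p ωᵢ` (the logarithmic series of the principal unit `ωᵢ`). [cite: Yu1990, §1.1] -/
def lgAll (i : Fin (S.d + 1)) : ℚ_[p] := PadicExp.plog (S.ω i)

/-- `lg j = log_p ω_{αⱼ}` (`j < d`). [cite: Yu1990, §1.1] -/
def lg (j : Fin S.d) : ℚ_[p] := S.lgAll (Fin.castSucc j)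

/-- `lgθ = log_p ω_θ`. [cite: Yu1990, §1.1] -/
def lgθ : ℚ_[p] := S.lgAll (Fin.last S.d)

/-- **`‖log_p ωᵢ‖ = ‖ωᵢ − 1‖ ≤ p⁻¹`.** [cite: Yu1990, §1.1] -/
theorem norm_lgAll_le (i : Fin (S.d + 1)) : ‖S.lgAll i‖ ≤ (p : ℝ)⁻¹ := by
  unfold lgAll
  rw [PadicExp.norm_plog S.hp3 (S.norm_one_sub_ω_le i)]
  exact S.norm_one_sub_ω_le i

/-- `‖lg j‖ ≤ p⁻¹`. [cite: Yu1990, §1.1] -/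
theorem norm_lg_le (j : Fin S.d) : ‖S.lg j‖ ≤ (p : ℝ)⁻¹ := S.norm_lgAll_le _

/-- `‖lgθ‖ ≤ p⁻¹`. [cite: Yu1990, §1.1] -/
theorem norm_lgθ_le : ‖S.lgθ‖ ≤ (p : ℝ)⁻¹ := S.norm_lgAll_le _

/-- **`exp (log_p ωᵢ) = ωᵢ`.** [cite: Yu1990, §1.1] -/
theorem exp_lgAll (i : Fin (S.d + 1)) : exp (S.lgAll i) = S.ω i :=
  PadicExp.exp_plog S.hp3 (S.norm_one_sub_ω_le i)

/-- `exp (s · log_p ωᵢ) = ωᵢˢ`. [cite: Yu1990, §1.1] -/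
theorem exp_natCast_mul_lgAll (i : Fin (S.d + 1)) (s : ℕ) :
    exp ((s : ℚ_[p]) * S.lgAll i) = S.ω i ^ s :=
  PadicExp.exp_natCast_mul_plog S.hp3 (S.norm_one_sub_ω_le i) s

/-! ### The linear form -/

/-- `‖b_θ‖_p ≤ 1`. [folklore] -/
theorem norm_bθ_le : ‖(S.bθ : ℚ_[p])‖ ≤ 1 := Padic.norm_int_le_one _

/-- `0 < ‖b_θ‖_p`. [folklore] -/
theorem norm_bθ_pos : 0 < ‖(S.bθ : ℚ_[p])‖ := norm_pos_iff.mpr (by exact_mod_cast S.bθ_ne)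


/-- **The linear form** `Λ = ∑ bⱼ log_p ω_{αⱼ} + b_θ log_p ω_θ ∈ ℚ_p`. [cite: Yu1990, Theorem 2.1] -/
def Λ : ℚ_[p] := ∑ j, (S.b j : ℚ_[p]) * S.lg j + (S.bθ : ℚ_[p]) * S.lgθ

/-- `Λ₀ = ∑ βⱼ lg j − lgθ` (`= −Λ/b_θ`). [cite: CijsouwWaldschmidt1977, Prop 1 (p. 183)] -/
def Λ₀ : ℚ_[p] := ∑ j : Fin S.d, (S.frame.β j : ℚ_[p]) * S.lg j - S.lgθ

/-- `Λ = −b_θ Λ₀`. [folklore] -/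
theorem Λ_eq : S.Λ = -(S.bθ : ℚ_[p]) * S.Λ₀ := by
  have hb : (S.bθ : ℚ_[p]) ≠ 0 := by exact_mod_cast S.bθ_ne
  unfold Λ Λ₀
  have e : ∀ j : Fin S.d, (S.frame.β j : ℚ_[p]) * S.lg j = -((S.b j : ℚ_[p]) * S.lg j) / S.bθ := by
    intro j; rw [show S.frame.β j = -(S.b j : ℚ) / S.bθ from rfl]; push_cast; field_simp
  simp_rw [e]
  rw [← Finset.sum_div, Finset.sum_neg_distrib]
  field_simp
  ring

/-- **`‖Λ‖ = ‖b_θ‖_p · ‖Λ₀‖`.** [folklore] -/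
theorem norm_Λ_eq_mul : ‖S.Λ‖ = ‖(S.bθ : ℚ_[p])‖ * ‖S.Λ₀‖ := by
  rw [S.Λ_eq, norm_mul, norm_neg]

/-- The number `Θ = ∏ αⱼ^{bⱼ} θ^{b_θ} ∈ ℚ` whose distance to `1` is measured. [cite: Yu1990, Theorem 2.1] -/
def Θ : ℚ := (∏ j, S.α j ^ S.b j) * S.θ ^ S.bθ

/-- All `d + 1` exponents: `bⱼ` (`j < d`) and `b_θ` (last). [folklore] -/
def ball : Fin (S.d + 1) → ℤ := Fin.snoc S.b S.bθ

/-- `Θ = ∏ᵢ allᵢ^{ballᵢ}` in `ℚ_p`. [folklore] -/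
theorem Θ_eq_prod_all : (S.Θ : ℚ_[p]) = ∏ i : Fin (S.d + 1), (S.toQ.all i : ℚ_[p]) ^ S.ball i := by
  unfold Θ SetupQ.all ball
  rw [Fin.prod_univ_castSucc]
  simp only [Fin.snoc_castSucc, Fin.snoc_last]
  push_cast
  rfl

/-- The root of unity `ρ_b = ∏ᵢ ηᵢ^{ballᵢ}` carried by `Θ`. [folklore] -/
def ηb : ℚ_[p] := ∏ i : Fin (S.d + 1), S.η i ^ S.ball i

/-- `ρ_b^G = 1`. [folklore] -/
theorem ηb_pow_G : S.ηb ^ S.G = 1 := by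
  unfold ηb
  rw [← prod_pow]
  refine prod_eq_one fun i _ => ?_
  rw [← zpow_natCast, ← zpow_mul, mul_comm, zpow_mul, zpow_natCast, S.hηG, one_zpow]

/-- The twisted number `Ω = ∏ᵢ ωᵢ^{ballᵢ} = Θ · ρ_b`. [folklore] -/
theorem prod_ω_zpow_eq : ∏ i : Fin (S.d + 1), S.ω i ^ S.ball i = (S.Θ : ℚ_[p]) * S.ηb := by
  unfold ω ηb
  rw [S.Θ_eq_prod_all, ← prod_mul_distrib]
  exact prod_congr rfl fun i _ => mul_zpow _ _ _

/-- **`Λ = log_p Ω`**, `Ω = ∏ᵢ ωᵢ^{ballᵢ}`. [cite: Yu1990, §1.1] -/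
theorem Λ_eq_plog : S.Λ = PadicExp.plog (∏ i : Fin (S.d + 1), S.ω i ^ S.ball i) := by
  have hlt : ∀ i : Fin (S.d + 1), ‖1 - S.ω i‖ < 1 := fun i =>
    (S.norm_one_sub_ω_le i).trans_lt S.inv_p_lt_one
  rw [PadicExp.plog_prod_zpow (ℓ := p) univ _ _ fun i _ => hlt i]
  unfold Λ ball lg lgθ lgAll
  rw [Fin.sum_univ_castSucc]
  simp only [Fin.snoc_castSucc, Fin.snoc_last]

/-- `Ω` is a principal unit: `‖1 − Ω‖ ≤ p⁻¹`. [folklore] -/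
theorem norm_one_sub_prod_ω_zpow_le : ‖1 - ∏ i : Fin (S.d + 1), S.ω i ^ S.ball i‖ ≤ (p : ℝ)⁻¹ :=
  PadicExp.norm_one_sub_prod_zpow_le S.inv_p_nonneg S.inv_p_lt_one univ _ _
    fun i _ => S.norm_one_sub_ω_le i

/-- **`‖Λ‖ = ‖Ω − 1‖_p`** with `Ω = Θ · ρ_b`. [cite: Yu1990, §1.1] -/
theorem norm_Λ : ‖S.Λ‖ = ‖(S.Θ : ℚ_[p]) * S.ηb - 1‖ := by
  rw [S.Λ_eq_plog, PadicExp.norm_plog S.hp3 S.norm_one_sub_prod_ω_zpow_le, norm_sub_rev,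
    S.prod_ω_zpow_eq]

/-- **A principal unit of finite ODD order is `1`**: `‖x − 1‖ ≤ p⁻¹`, `x^G = 1`, `G` odd ⇒ `x = 1`
(`G · log_p x = log_p x^G = 0` and `log_p` is injective on principal units).
[cite: Yu1990, §1.1] -/
theorem eq_one_of_pow_eq_one_of_norm_sub_one_le {x : ℚ_[p]} (hx : ‖x - 1‖ ≤ (p : ℝ)⁻¹)
    (hxG : x ^ S.G = 1) : x = 1 := by
  have hx' : ‖1 - x‖ ≤ (p : ℝ)⁻¹ := by rwa [norm_sub_rev]
  have h1 : PadicExp.plog (x ^ S.G) = (S.G : ℚ_[p]) * PadicExp.plog x :=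
    PadicExp.plog_pow (ℓ := p) (hx'.trans_lt S.inv_p_lt_one) S.G
  rw [hxG, PadicExp.plog_one] at h1
  have hG0 : (S.G : ℚ_[p]) ≠ 0 := by exact_mod_cast S.hG.ne'
  have hlog : PadicExp.plog x = 0 := by
    rcases mul_eq_zero.mp h1.symm with h | h
    · exact absurd h hG0
    · exact h
  have h2 := PadicExp.exp_plog S.hp3 hx'
  rw [hlog, NormedSpace.exp_zero] at h2
  exact h2.symm

/-- **`‖Λ‖ = ‖Θ − 1‖_p` when `Θ` is a principal unit**: then `ρ_b = Ω · Θ⁻¹` is a principal unit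
of odd order, hence `1`. [cite: Yu1990, §2 (2.18)] -/
theorem norm_Λ_of_principal (hΘ : ‖(S.Θ : ℚ_[p]) - 1‖ ≤ (p : ℝ)⁻¹) :
    ‖S.Λ‖ = ‖(S.Θ : ℚ_[p]) - 1‖ := by
  have hΘ1 : ‖1 - (S.Θ : ℚ_[p])‖ ≤ (p : ℝ)⁻¹ := by rwa [norm_sub_rev]
  have hΘne : (S.Θ : ℚ_[p]) ≠ 0 := by
    intro h; rw [h, sub_zero, norm_one] at hΘ1
    exact absurd hΘ1 (not_le.mpr S.inv_p_lt_one)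
  have hΩ : ‖1 - (S.Θ : ℚ_[p]) * S.ηb‖ ≤ (p : ℝ)⁻¹ := by
    rw [← S.prod_ω_zpow_eq]; exact S.norm_one_sub_prod_ω_zpow_le
  -- `ρ_b = Ω · Θ⁻¹` is principal
  have hρ : ‖1 - S.ηb‖ ≤ (p : ℝ)⁻¹ := by
    have e : S.ηb = ((S.Θ : ℚ_[p]) * S.ηb) * (S.Θ : ℚ_[p])⁻¹ := by
      field_simp
    rw [e]
    exact PadicExp.norm_one_sub_mul_le S.inv_p_lt_one hΩ
      (PadicExp.norm_one_sub_inv_le S.inv_p_lt_one hΘ1)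
  have hρ1 : S.ηb = 1 :=
    S.eq_one_of_pow_eq_one_of_norm_sub_one_le (by rwa [norm_sub_rev]) S.ηb_pow_G
  rw [S.norm_Λ, hρ1, mul_one]

end TwistSetup

end Summit.ABC.StewartYu

end
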